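import Literature.Probability.LatticeModels.UrsellMonotonicityTwo
import HarnessLib

/-!
# The two-current cluster calculus: conditioning a pair of currents on the cluster of a root

Topic `Literature/Probability/LatticeModels`; continues `UrsellMonotonicityTwo` (Part I) and
`WeightedClusterDecomposition`.  For edge couplings `K ≥ 0` on a finite simple graph `G`, a root `u`, a
vertex set `A` and two source sets `S, T` let

  `J_A(S,T) = jmass K u A S T := Σ_{(p₁,p₂)} 1{∂p₁ = S} 1{∂p₂ = T} w(p₁) w(p₂) 1{C_{p₁+p₂}(u) = A}`

(the two-current mass with the cluster of `u` in `p₁ + p₂` frozen to `A`).  We prove the three exact rules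
of the calculus behind the all-orders sign/monotonicity theorem for Ising Ursell functions
(evidence `full_proof.md` of the CamiaJiangNewman2023 unit, "Lemma 1–2 / (†)"):

* `Current.tsum_epairWeight_eq_sum_jmass` — resolving by the cluster: `Z[S] Z[T] = Σ_A J_A(S,T)`;
* `Current.jmass_splice` — **conditioning on the cluster** (both slots): with `Z_A` the current sums for
  the couplings cut off at `A` (`cutCoupling`, the model `G ∖ A`),
  `J_A(S,T) · Z_A[∅]² = J_A(S ∩ A, T ∩ A) · Z_A[S ∖ A] · Z_A[T ∖ A]` (the involution exchanging the parts
  of `pᵢ` off `A` with an outer pair, `Current.splice_transfer`; the one-slot case is `Current.pair_splice`);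
* `Current.jmass_switch` / `Current.jmass_switch_all` — **switching inside the cluster**: for sources
  inside `A` the pair `(S, T)` may be replaced by `(S ∪ T, ∅)` (the switching lemma
  `Current.etsum_switching_univ`; the connection indicator it produces is `1` on `{C(u) = A}`).

and their real-valued combination `Current.corr_mul_corr_eq_sum` ("(†')"):
`⟨σ_𝒯⟩⟨σ_𝒮⟩ = Σ_{A} ρI_A((𝒯 ∪ 𝒮) ∩ A) ⟨σ_{𝒯∖A}⟩_A ⟨σ_{𝒮∖A}⟩_A` for disjoint `𝒯, 𝒮`, where
`⟨σ_B⟩ = Z[B]/Z[∅]`, `⟨·⟩_A` is the state with the couplings at `A` cut off and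
`ρI_A(B) = J_A(B,∅)/Z[∅]²`.  Nothing here is a named fact.

## References

* M. Aizenman, Comm. Math. Phys. 86 (1982), §5 (conditioning on clusters) [AizenmanCMP1982];
  R. Panis, arXiv:2309.05797, Lemma 4.4 (switching lemma) [Panis2023Triviality]; through the tree files
  `WeightedCurrentsSwitching`, `WeightedClusterDecomposition`, `UrsellMonotonicityTwo`.
-/

noncomputable section

open Finset Filter
open scoped symmDiff ENNReal

namespace Literature.Probability.LatticeModels

variable {V : Type*} [Fintype V] [DecidableEq V] {G : SimpleGraph V} [DecidableRel G.Adj]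

namespace Current

variable {K : G.edgeFinset → ℝ}

/-! ### The frozen-cluster two-current mass -/

/-- **The two-current mass with frozen cluster**
`J_A(S,T) = Σ 1{∂p₁ = S} 1{∂p₂ = T} w w 1{C_{p₁+p₂}(u) = A}`. [cite: AizenmanCMP1982, §5 (conditioning on clusters)] -/
def jmass (K : G.edgeFinset → ℝ) (u : V) (A S T : Finset V) : ℝ≥0∞ :=
  ∑' p : Current G × Current G, epairWeight K S T p * (if (p.1 + p.2).cluster u = A then 1 else 0)

/-- `J_A(S,∅)` is the frozen-cluster pair mass `M^1_A(S)` of `UrsellMonotonicityTwo`. [folklore] -/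
theorem jmass_empty_eq_pmass (K : G.edgeFinset → ℝ) (u : V) (A S : Finset V) :
    jmass K u A S ∅ = pmass K u A S (fun _ => 1) := by
  unfold jmass pmass
  simp only [mul_one]

/-- `J_A(S,T) ≤ Z[S] Z[T]`. [folklore] -/
theorem jmass_le (K : G.edgeFinset → ℝ) (u : V) (A S T : Finset V) :
    jmass K u A S T ≤ ecurrentSum K S * ecurrentSum K T := by
  rw [← tsum_epairWeight]
  unfold jmass
  refine ENNReal.tsum_le_tsum fun p => ?_
  calc epairWeight K S T p * (if (p.1 + p.2).cluster u = A then 1 else 0) ≤ epairWeight K S T p * 1 :=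
        mul_le_mul' le_rfl (by split_ifs <;> simp)
    _ = _ := mul_one _

/-- `J_A(S,T) < ∞` for `K ≥ 0`. [folklore] -/
theorem jmass_ne_top (hK : ∀ e, 0 ≤ K e) (u : V) (A S T : Finset V) : jmass K u A S T ≠ ∞ :=
  ne_top_of_le_ne_top (ENNReal.mul_ne_top (ecurrentSum_ne_top hK S) (ecurrentSum_ne_top hK T)) (jmass_le K u A S T)

/-- `J_A(S,T) = 0` unless `u ∈ A`. [folklore] -/
theorem jmass_eq_zero_of_notMem (K : G.edgeFinset → ℝ) {u : V} {A : Finset V} (hu : u ∉ A) (S T : Finset V) :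
    jmass K u A S T = 0 := by
  unfold jmass
  refine ENNReal.tsum_eq_zero.2 fun p => ?_
  have h : ¬ (p.1 + p.2).cluster u = A := fun h => hu (h ▸ mem_cluster_self (p.1 + p.2) u)
  rw [if_neg h, mul_zero]

/-- **Resolving a product of current sums by the cluster of the root**: `Z[S] Z[T] = Σ_A J_A(S,T)`. [folklore] -/
theorem tsum_epairWeight_eq_sum_jmass (K : G.edgeFinset → ℝ) (u : V) (S T : Finset V) :
    ecurrentSum K S * ecurrentSum K T = ∑ A : Finset V, jmass K u A S T := by
  rw [← tsum_epairWeight]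
  have h := tsum_pair_mul_apply_cluster_eq_sum (epairWeight K S T) (fun _ => 1) u
  simp only [mul_one] at h
  exact h

/-! ### Conditioning on the cluster (both slots) -/

/-- **The two-slot pair splice identity**:
`J_A(S,T) · Z_A[∅]² = J_A(S ∩ A, T ∩ A) · Z_A[S ∖ A] · Z_A[T ∖ A]`, `Z_A` the current sums for the couplings cut
off at `A`.  The involution exchanges the parts off `A` of `p₁, p₂` with an outer pair `(q₁,q₂)` supported off `A`
(`Current.splice_transfer`), preserving `w(p₁)w(p₂)w(q₁)w(q₂)` and the cluster of `u`.
[cite: AizenmanCMP1982, §5 (conditioning on clusters)] -/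
theorem jmass_splice (hK : ∀ e, 0 ≤ K e) (u : V) (A S T : Finset V) :
    jmass K u A S T * (ecurrentSum (cutCoupling K A) ∅ * ecurrentSum (cutCoupling K A) ∅) =
      jmass K u A (S.filter (· ∈ A)) (T.filter (· ∈ A)) *
        (ecurrentSum (cutCoupling K A) (S.filter (· ∉ A)) * ecurrentSum (cutCoupling K A) (T.filter (· ∉ A))) := by
  rw [← tsum_epairWeight, ← tsum_epairWeight]
  unfold jmass
  -- normal forms of the two sides as sums over quadruples
  set PA : (Current G × Current G) × (Current G × Current G) → Prop := fun x =>
    (x.1.1.sources = S ∧ x.1.2.sources = T) ∧ (x.1.1 + x.1.2).cluster u = A ∧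
      ((IsSupp (offGraph G A) x.2.1 ∧ x.2.1.sources = ∅) ∧ (IsSupp (offGraph G A) x.2.2 ∧ x.2.2.sources = ∅))
    with hPA
  set PB : (Current G × Current G) × (Current G × Current G) → Prop := fun x =>
    (x.1.1.sources = S.filter (· ∈ A) ∧ x.1.2.sources = T.filter (· ∈ A)) ∧ (x.1.1 + x.1.2).cluster u = A ∧
      ((IsSupp (offGraph G A) x.2.1 ∧ x.2.1.sources = S.filter (· ∉ A)) ∧
        (IsSupp (offGraph G A) x.2.2 ∧ x.2.2.sources = T.filter (· ∉ A))) with hPB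
  set w : (Current G × Current G) × (Current G × Current G) → ℝ≥0∞ := fun x =>
    x.1.1.eweight K * x.1.2.eweight K * (x.2.1.eweight K * x.2.2.eweight K) with hw
  have hL : (∑' p : Current G × Current G,
        epairWeight K S T p * (if (p.1 + p.2).cluster u = A then 1 else 0)) *
      (∑' q : Current G × Current G, epairWeight (cutCoupling K A) ∅ ∅ q) =
      ∑' x, (if PA x then w x else 0) := by
    rw [tsum_mul_tsum_eq_tsum_prod]
    refine tsum_congr fun x => ?_
    rw [epairWeight_cutCoupling, epairWeight]
    by_cases h1 : x.1.1.sources = S ∧ x.1.2.sources = T <;>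
      by_cases h2 : (x.1.1 + x.1.2).cluster u = A <;>
      by_cases h3 : (IsSupp (offGraph G A) x.2.1 ∧ x.2.1.sources = ∅) ∧
        (IsSupp (offGraph G A) x.2.2 ∧ x.2.2.sources = ∅) <;>
      simp [hPA, hw, h1, h2, h3, mul_assoc]
  have hR : (∑' p : Current G × Current G,
        epairWeight K (S.filter (· ∈ A)) (T.filter (· ∈ A)) p * (if (p.1 + p.2).cluster u = A then 1 else 0)) *
      (∑' q : Current G × Current G, epairWeight (cutCoupling K A) (S.filter (· ∉ A)) (T.filter (· ∉ A)) q) =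
      ∑' x, (if PB x then w x else 0) := by
    rw [tsum_mul_tsum_eq_tsum_prod]
    refine tsum_congr fun x => ?_
    rw [epairWeight_cutCoupling, epairWeight]
    by_cases h1 : x.1.1.sources = S.filter (· ∈ A) ∧ x.1.2.sources = T.filter (· ∈ A) <;>
      by_cases h2 : (x.1.1 + x.1.2).cluster u = A <;>
      by_cases h3 : (IsSupp (offGraph G A) x.2.1 ∧ x.2.1.sources = S.filter (· ∉ A)) ∧
        (IsSupp (offGraph G A) x.2.2 ∧ x.2.2.sources = T.filter (· ∉ A)) <;>
      simp [hPB, hw, h1, h2, h3, mul_assoc]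
  rw [hL, hR]
  -- the involution
  set f : (Current G × Current G) × (Current G × Current G) → (Current G × Current G) × (Current G × Current G) :=
    fun x => ((spliceOff A x.1.1 x.2.1, spliceOff A x.1.2 x.2.2), (spliceOff A x.2.1 x.1.1, spliceOff A x.2.2 x.1.2))
    with hf
  have hinv : Function.Involutive f := by
    rintro ⟨⟨p₁, p₂⟩, ⟨q₁, q₂⟩⟩
    simp only [hf, spliceOff_spliceOff]
  have hself : ∀ (X : Finset V), (X.filter (· ∈ A)).filter (· ∈ A) = X.filter (· ∈ A) := fun X => by
    rw [Finset.filter_filter]; exact Finset.filter_congr fun x _ => and_self_iff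
  have hself' : ∀ (X : Finset V), (X.filter (· ∉ A)).filter (· ∉ A) = X.filter (· ∉ A) := fun X => by
    rw [Finset.filter_filter]; exact Finset.filter_congr fun x _ => and_self_iff
  have hnone : ∀ (X : Finset V), (X.filter (· ∈ A)).filter (· ∉ A) = ∅ := fun X => by
    rw [Finset.filter_filter]; exact Finset.filter_false_of_mem fun x _ h => h.2 h.1
  -- transfer of the constraints along `f`
  have htrans : ∀ x, PA x → PB (f x) ∧ w x = w (f x) := by
    rintro ⟨⟨p₁, p₂⟩, ⟨q₁, q₂⟩⟩ ⟨⟨hp₁, hp₂⟩, hC, ⟨hq₁, hq₁s⟩, ⟨hq₂, hq₂s⟩⟩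
    have hC' : (p₂ + p₁).cluster u = A := by rwa [add_comm]
    obtain ⟨-, hsupp₁, hsrc₁, hsrc₁'⟩ := splice_transfer hC' hq₁
    obtain ⟨-, hsupp₂, hsrc₂, hsrc₂'⟩ := splice_transfer hC hq₂
    have hCf : (spliceOff A p₁ q₁ + spliceOff A p₂ q₂).cluster u = A :=
      cluster_eq_of_agree hC fun e he => by
        simp only [Pi.add_apply, spliceOff_apply_of_not_edgeOff _ _ he]
    refine ⟨⟨⟨?_, ?_⟩, hCf, ⟨hsupp₁, ?_⟩, ⟨hsupp₂, ?_⟩⟩, ?_⟩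
    · rw [hsrc₁', hp₁, hq₁s, Finset.filter_empty, Finset.union_empty]
    · rw [hsrc₂', hp₂, hq₂s, Finset.filter_empty, Finset.union_empty]
    · rw [hsrc₁, hp₁]
    · rw [hsrc₂, hp₂]
    · simp only [hw, hf]
      calc p₁.eweight K * p₂.eweight K * (q₁.eweight K * q₂.eweight K)
          = (p₁.eweight K * q₁.eweight K) * (p₂.eweight K * q₂.eweight K) := by ring
        _ = ((spliceOff A p₁ q₁).eweight K * (spliceOff A q₁ p₁).eweight K) *
              ((spliceOff A p₂ q₂).eweight K * (spliceOff A q₂ p₂).eweight K) := by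
            rw [eweight_spliceOff_mul_eweight_spliceOff hK A p₁ q₁,
              eweight_spliceOff_mul_eweight_spliceOff hK A p₂ q₂]
        _ = _ := by ring
  have hback : ∀ x, PB (f x) → PA x := by
    rintro ⟨⟨p₁, p₂⟩, ⟨q₁, q₂⟩⟩ ⟨⟨hp₁, hp₂⟩, hC, ⟨hq₁, hq₁s⟩, ⟨hq₂, hq₂s⟩⟩
    simp only [hf] at hp₁ hp₂ hC hq₁ hq₁s hq₂ hq₂s
    have hC' : (spliceOff A p₂ q₂ + spliceOff A p₁ q₁).cluster u = A := by rwa [add_comm]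
    obtain ⟨-, hsupp₁, hsrc₁, hsrc₁'⟩ := splice_transfer hC' hq₁
    obtain ⟨-, hsupp₂, hsrc₂, hsrc₂'⟩ := splice_transfer hC hq₂
    rw [spliceOff_spliceOff] at hsupp₁ hsrc₁ hsrc₁' hsupp₂ hsrc₂ hsrc₂'
    have hCb : (p₁ + p₂).cluster u = A := by
      refine cluster_eq_of_agree hC fun e he => ?_
      simp only [Pi.add_apply, spliceOff]
      by_cases ho : EdgeOff A (e : Sym2 V)
      · exact absurd ho he
      · simp [ho]
    refine ⟨⟨?_, ?_⟩, hCb, ⟨hsupp₁, ?_⟩, ⟨hsupp₂, ?_⟩⟩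
    · rw [hsrc₁', hp₁, hq₁s, hself, hself', Finset.filter_union_filter_not_eq]
    · rw [hsrc₂', hp₂, hq₂s, hself, hself', Finset.filter_union_filter_not_eq]
    · rw [hsrc₁, hp₁, hnone]
    · rw [hsrc₂, hp₂, hnone]
  classical
  exact tsum_ite_eq_of_involutive f hinv PA PB w w (fun x hx => (htrans x hx).1)
    (fun q hq => hback (f q) (by rw [hinv q]; exact hq)) (fun x hx => (htrans x hx).2)

/-! ### Switching inside the cluster -/

/-- On `{C_{m}(u) = A}` two vertices of `A` are connected: the connection indicator is `1`. [folklore] -/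
theorem indicator_cluster_mul_connIn {u x y : V} {A : Finset V} (hx : x ∈ A) (hy : y ∈ A) (m : Current G)
    (c : ℝ≥0∞) :
    (if m.cluster u = A then c else 0) * (connIn G x y).indicator 1 m = if m.cluster u = A then c else 0 := by
  by_cases h : m.cluster u = A
  · rw [if_pos h, indicator_connIn_self_eq]
    have hxu : x ∈ m.cluster u := h ▸ hx
    have hyu : y ∈ m.cluster u := h ▸ hy
    rw [if_pos (mem_cluster_trans (mem_cluster_comm.1 hxu) hyu), mul_one]
  · rw [if_neg h, zero_mul]

/-- **Switching a pair of sources of the second current into the first, inside the frozen cluster**: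
for `x ≠ y ∈ A`, `J_A(S,T) = J_A(S Δ {x,y}, T Δ {x,y})`. [cite: Panis2023Triviality, Lemma 4.4] -/
theorem jmass_switch (hK : ∀ e, 0 ≤ K e) {u x y : V} {A : Finset V} (hx : x ∈ A) (hy : y ∈ A)
    (S T : Finset V) :
    jmass K u A S T = jmass K u A (S ∆ ({x} ∆ {y})) (T ∆ ({x} ∆ {y})) := by
  -- both sides in the normal form of `etsum_switching_univ` (with the trivial support condition and the
  -- connection indicator inserted, which is `1` on `{C(u) = A}`)
  have hnf : ∀ S' T' : Finset V, jmass K u A S' T' =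
      ∑' p : Current G × Current G,
        (if IsSupp G p.1 ∧ p.1.sources = S' then p.1.eweight K else 0) *
          (if p.2.sources = T' then p.2.eweight K else 0) *
          ((if (p.1 + p.2).cluster u = A then (1 : ℝ≥0∞) else 0) * (connIn G x y).indicator 1 (p.1 + p.2)) := by
    intro S' T'
    unfold jmass
    refine tsum_congr fun p => ?_
    rw [indicator_cluster_mul_connIn hx hy, epairWeight_eq_mul]
    simp only [isSupp_self, true_and]
  rw [hnf, hnf, etsum_switching_univ G hK S T x y (fun m => if m.cluster u = A then (1 : ℝ≥0∞) else 0)]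

/-- **All sources of the second current can be switched into the first, inside the frozen cluster**:
for `T ⊆ A` of even size and disjoint from `S`, `J_A(S,T) = J_A(S ∪ T, ∅)`. [cite: Panis2023Triviality, Lemma 4.4] -/
theorem jmass_switch_all (hK : ∀ e, 0 ≤ K e) (u : V) (A S : Finset V) :
    ∀ (T : Finset V), T ⊆ A → Even T.card → Disjoint S T → jmass K u A S T = jmass K u A (S ∪ T) ∅ := by
  intro T
  induction T using Finset.strongInduction generalizing S with
  | H T ih =>
    intro hTA hTe hST
    rcases T.eq_empty_or_nonempty with rfl | hne
    · rw [Finset.union_empty]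
    · obtain ⟨x, hx⟩ := hne
      have hcard : (T.erase x).card = T.card - 1 := Finset.card_erase_of_mem hx
      have hpos : 0 < T.card := Finset.card_pos.2 ⟨x, hx⟩
      have hne' : (T.erase x).Nonempty := by
        rw [← Finset.card_pos, hcard]
        obtain ⟨k, hk⟩ := hTe
        omega
      obtain ⟨y, hy⟩ := hne'
      have hyx : y ≠ x := (Finset.mem_erase.1 hy).1
      have hyT : y ∈ T := (Finset.mem_erase.1 hy).2
      -- switch the pair {x, y}
      rw [jmass_switch hK (hTA hx) (hTA hyT) S T]
      have hxy : ({x} : Finset V) ∆ {y} = {x, y} := by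
        ext v
        simp only [Finset.mem_symmDiff, Finset.mem_singleton, Finset.mem_insert]
        constructor
        · rintro (⟨h, -⟩ | ⟨h, -⟩)
          · exact Or.inl h
          · exact Or.inr h
        · rintro (h | h)
          · exact Or.inl ⟨h, fun h' => hyx (h'.symm.trans h)⟩
          · exact Or.inr ⟨h, fun h' => hyx (h.symm.trans h')⟩
      have hxS : x ∉ S := fun h => Finset.disjoint_left.1 hST h hx
      have hyS : y ∉ S := fun h => Finset.disjoint_left.1 hST h hyT
      have hS' : S ∆ ({x} ∆ {y}) = S ∪ {x, y} := by
        rw [hxy]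
        ext v
        simp only [Finset.mem_symmDiff, Finset.mem_union, Finset.mem_insert, Finset.mem_singleton]
        constructor
        · rintro (⟨h, -⟩ | ⟨h, -⟩)
          · exact Or.inl h
          · exact Or.inr h
        · rintro (h | h)
          · refine Or.inl ⟨h, ?_⟩
            rintro (rfl | rfl)
            · exact hxS h
            · exact hyS h
          · refine Or.inr ⟨h, fun hv => ?_⟩
            rcases h with rfl | rfl
            · exact hxS hv
            · exact hyS hv
      have hT' : T ∆ ({x} ∆ {y}) = (T.erase x).erase y := by
        rw [hxy]
        ext v
        simp only [Finset.mem_symmDiff, Finset.mem_erase, Finset.mem_insert, Finset.mem_singleton]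
        constructor
        · rintro (⟨h, h'⟩ | ⟨h, h'⟩)
          · exact ⟨fun e => h' (Or.inr e), fun e => h' (Or.inl e), h⟩
          · rcases h with rfl | rfl
            · exact absurd hx h'
            · exact absurd hyT h'
        · rintro ⟨h1, h2, h3⟩
          exact Or.inl ⟨h3, fun h => h.elim h2 h1⟩
      rw [hS', hT']
      have hsub : (T.erase x).erase y ⊂ T :=
        lt_of_le_of_lt (Finset.erase_subset _ _) (Finset.erase_ssubset hx)
      have hsubA : (T.erase x).erase y ⊆ A := (hsub.subset).trans hTA
      have heven : Even ((T.erase x).erase y).card := by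
        rw [Finset.card_erase_of_mem hy, hcard]
        obtain ⟨k, hk⟩ := hTe
        refine ⟨k - 1, ?_⟩
        omega
      have hdisj : Disjoint (S ∪ {x, y}) ((T.erase x).erase y) := by
        rw [Finset.disjoint_left]
        intro v hv hv'
        simp only [Finset.mem_erase] at hv'
        rcases Finset.mem_union.1 hv with h | h
        · exact Finset.disjoint_left.1 hST h hv'.2.2
        · rcases Finset.mem_insert.1 h with rfl | h
          · exact hv'.2.1 rfl
          · exact hv'.1 (Finset.mem_singleton.1 h)
      rw [ih _ hsub (S ∪ {x, y}) hsubA heven hdisj]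
      congr 1
      ext v
      simp only [Finset.mem_union, Finset.mem_insert, Finset.mem_singleton, Finset.mem_erase]
      constructor
      · rintro ((h | h) | ⟨-, -, h⟩)
        · exact Or.inl h
        · rcases h with rfl | rfl
          · exact Or.inr hx
          · exact Or.inr hyT
        · exact Or.inr h
      · rintro (h | h)
        · exact Or.inl (Or.inl h)
        · by_cases hvx : v = x
          · exact Or.inl (Or.inr (Or.inl hvx))
          · by_cases hvy : v = y
            · exact Or.inl (Or.inr (Or.inr hvy))
            · exact Or.inr ⟨hvy, hvx, h⟩

/-! ### Parity: source counts in closed vertex sets -/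

/-- **Handshake on a closed vertex set.**  If every edge carrying current meets `C` in `0` or `2` endpoints,
then `C` contains an even number of sources. [cite: DuminilCopin2016, §2.2] -/
theorem even_card_filter_mem_sources (n : Current G) (C : Finset V)
    (hC : ∀ e : G.edgeFinset, 0 < n e → ∀ v ∈ (e : Sym2 V), ∀ w ∈ (e : Sym2 V), (v ∈ C ↔ w ∈ C)) :
    Even #(C.filter fun v => v ∈ n.sources) := by
  have hfilter : C.filter (fun v => v ∈ n.sources) = C.filter (fun v => Odd (n.degree v)) := by
    ext v; simp only [Finset.mem_filter, mem_sources_iff]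
  rw [hfilter, ← Finset.even_sum_iff_even_card_odd]
  have hsum : ∑ v ∈ C, n.degree v = ∑ e : G.edgeFinset, n e * #(C.filter fun v => v ∈ (e : Sym2 V)) := by
    unfold degree
    rw [Finset.sum_comm]
    refine Finset.sum_congr rfl fun e _ => ?_
    rw [← Finset.sum_filter, Finset.sum_const, smul_eq_mul, mul_comm]
  rw [hsum]
  refine Finset.even_sum _ fun e _ => ?_
  rcases Nat.eq_zero_or_pos (n e) with h0 | hpos
  · rw [h0, zero_mul]; exact Even.zero
  · refine Nat.even_mul.2 (Or.inr ?_)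
    have hce := hC e hpos
    obtain ⟨e, he⟩ := e
    induction e using Sym2.ind with
    | _ a b =>
      have hab : a ≠ b := G.ne_of_adj (SimpleGraph.mem_edgeFinset.1 he)
      have hiff : a ∈ C ↔ b ∈ C := hce a (Sym2.mem_mk_left a b) b (Sym2.mem_mk_right a b)
      have hfil : C.filter (fun v => v ∈ (s(a, b) : Sym2 V)) = ({a, b} : Finset V).filter (· ∈ C) := by
        ext v
        simp only [Finset.mem_filter, Sym2.mem_iff, Finset.mem_insert, Finset.mem_singleton]
        tauto
      change Even #(C.filter fun v => v ∈ (s(a, b) : Sym2 V))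
      rw [hfil, Finset.filter_insert, Finset.filter_singleton]
      by_cases ha : a ∈ C
      · have hb : b ∈ C := hiff.1 ha
        rw [if_pos ha, if_pos hb, Finset.card_insert_of_notMem (by simpa using hab)]
        simp
      · have hb : b ∉ C := fun hb => ha (hiff.2 hb)
        rw [if_neg ha, if_neg hb]
        simp

/-- Every current has an even number of sources. [cite: DuminilCopin2016, §2.2] -/
theorem even_card_sources (n : Current G) : Even #n.sources := by
  have h := even_card_filter_mem_sources n univ (fun _ _ _ _ _ _ => by simp)
  rwa [Finset.filter_mem_eq_inter, Finset.univ_inter] at h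

/-- The sources of `p₂` inside the cluster of `u` in `p₁ + p₂` are even in number. [cite: DuminilCopin2016, §2.2] -/
theorem even_card_filter_mem_sources_of_cluster_eq {p₁ p₂ : Current G} {u : V} {A : Finset V}
    (hA : (p₁ + p₂).cluster u = A) : Even #(A.filter fun v => v ∈ p₂.sources) := by
  refine even_card_filter_mem_sources p₂ A fun e he v hv w hw => ?_
  have he' : 0 < (p₁ + p₂) e := lt_of_lt_of_le he (by simp)
  rw [← hA]
  exact ⟨fun hvA => forall_mem_cluster_of_pos he' hv hvA w hw, fun hwA => forall_mem_cluster_of_pos he' hw hwA v hv⟩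

/-- No current has an odd source set: `Z_K[B] = 0` for `#B` odd. [folklore] -/
theorem wcurrentSum_eq_zero_of_odd (K : G.edgeFinset → ℝ) {B : Finset V} (hB : Odd #B) :
    wcurrentSum K B = 0 := by
  unfold wcurrentSum
  refine (tsum_congr fun n => ?_).trans tsum_zero
  rw [if_neg]
  rintro rfl
  exact (Nat.not_even_iff_odd.2 hB) (even_card_sources n)

/-- `J_A(S,T) = 0` when `T ⊆ A` has odd size. [folklore] -/
theorem jmass_eq_zero_of_odd (K : G.edgeFinset → ℝ) (u : V) {A T : Finset V} (S : Finset V) (hTA : T ⊆ A)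
    (hT : Odd #T) : jmass K u A S T = 0 := by
  unfold jmass epairWeight
  refine ENNReal.tsum_eq_zero.2 fun p => ?_
  by_cases hC : (p.1 + p.2).cluster u = A
  · by_cases hs : p.1.sources = S ∧ p.2.sources = T
    · exfalso
      have h := even_card_filter_mem_sources_of_cluster_eq hC
      rw [hs.2, Finset.filter_mem_eq_inter, Finset.inter_eq_right.2 hTA] at h
      exact (Nat.not_even_iff_odd.2 hT) h
    · rw [if_neg hs, zero_mul]
  · rw [if_neg hC, mul_zero]

/-! ### The real-valued form (†') -/

/-- The correlation-like ratio `⟨σ_B⟩_K = Z_K[B]/Z_K[∅]`. [cite: Panis2023Triviality, §4.1] -/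
def corrK (K : G.edgeFinset → ℝ) (B : Finset V) : ℝ := wcurrentSum K B / wcurrentSum K ∅

/-- The normalised cluster weight `ρI_A(B) = J_A(B,∅)/Z[∅]²` (real). [cite: AizenmanCMP1982, §5 (conditioning on clusters)] -/
def rhoI (K : G.edgeFinset → ℝ) (u : V) (A B : Finset V) : ℝ :=
  (jmass K u A B ∅).toReal / (wcurrentSum K ∅ * wcurrentSum K ∅)

/-- `ρI_A(B) ≥ 0`. [folklore] -/
theorem rhoI_nonneg (hK : ∀ e, 0 ≤ K e) (u : V) (A B : Finset V) : 0 ≤ rhoI K u A B :=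
  div_nonneg ENNReal.toReal_nonneg (mul_nonneg (wcurrentSum_nonneg hK ∅) (wcurrentSum_nonneg hK ∅))

/-- The splice identity in `ℝ`. [folklore] -/
theorem toReal_jmass_splice (hK : ∀ e, 0 ≤ K e) (u : V) (A S T : Finset V) :
    (jmass K u A S T).toReal * (wcurrentSum (cutCoupling K A) ∅ * wcurrentSum (cutCoupling K A) ∅) =
      (jmass K u A (S.filter (· ∈ A)) (T.filter (· ∈ A))).toReal *
        (wcurrentSum (cutCoupling K A) (S.filter (· ∉ A)) * wcurrentSum (cutCoupling K A) (T.filter (· ∉ A))) := by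
  have h := jmass_splice hK u A S T
  have hKA := cutCoupling_nonneg hK A
  apply_fun ENNReal.toReal at h
  simpa only [ENNReal.toReal_mul, toReal_ecurrentSum hKA] using h

/-- The splice-and-switch identity per cluster, in `ℝ`: for disjoint `𝒯, 𝒮` with `#𝒮` even,
`J_A(𝒯,𝒮) · Z_A[∅]² = J_A((𝒯 ∪ 𝒮) ∩ A, ∅) · Z_A[𝒯 ∖ A] · Z_A[𝒮 ∖ A]`. [cite: AizenmanCMP1982, §5 (conditioning on clusters)] -/
theorem toReal_jmass_mul_eq (hK : ∀ e, 0 ≤ K e) (u : V) (A : Finset V) {𝒯 𝒮 : Finset V} (hd : Disjoint 𝒯 𝒮)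
    (h𝒮 : Even #𝒮) :
    (jmass K u A 𝒯 𝒮).toReal * (wcurrentSum (cutCoupling K A) ∅ * wcurrentSum (cutCoupling K A) ∅) =
      (jmass K u A ((𝒯 ∪ 𝒮).filter (· ∈ A)) ∅).toReal *
        (wcurrentSum (cutCoupling K A) (𝒯.filter (· ∉ A)) * wcurrentSum (cutCoupling K A) (𝒮.filter (· ∉ A))) := by
  rw [toReal_jmass_splice hK u A 𝒯 𝒮]
  rcases Nat.even_or_odd #(𝒮.filter (· ∈ A)) with heven | hodd
  · rw [jmass_switch_all hK u A (𝒯.filter (· ∈ A)) (𝒮.filter (· ∈ A)) (fun v hv => (Finset.mem_filter.1 hv).2)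
      heven (Finset.disjoint_filter_filter hd), Finset.filter_union]
  · have hodd' : Odd #(𝒮.filter (· ∉ A)) := by
      have hsum := Finset.card_filter_add_card_filter_not (s := 𝒮) (fun v => v ∈ A)
      rcases h𝒮 with ⟨k, hk⟩
      rcases hodd with ⟨j, hj⟩
      refine Nat.odd_iff.2 ?_
      omega
    rw [jmass_eq_zero_of_odd K u (𝒯.filter (· ∈ A)) (fun v hv => (Finset.mem_filter.1 hv).2) hodd,
      wcurrentSum_eq_zero_of_odd (cutCoupling K A) hodd']
    simp

/-- **(†') The two-current cluster identity in correlation form.**  For `K ≥ 0`, a root `u` and disjoint source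
sets `𝒯, 𝒮` with `#𝒮` even:  `⟨σ_𝒯⟩⟨σ_𝒮⟩ = Σ_A ρI_A((𝒯 ∪ 𝒮) ∩ A) · ⟨σ_{𝒯∖A}⟩_A · ⟨σ_{𝒮∖A}⟩_A`, where `⟨·⟩_A` is the
ratio of current sums for the couplings cut off at `A` — cluster of `u` in the pair of currents, its sources switched
into the first current, the parts off the cluster spliced out. [cite: AizenmanCMP1982, §5 (conditioning on clusters)] -/
theorem corr_mul_corr_eq_sum (hK : ∀ e, 0 ≤ K e) (u : V) {𝒯 𝒮 : Finset V} (hd : Disjoint 𝒯 𝒮) (h𝒮 : Even #𝒮) :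
    corrK K 𝒯 * corrK K 𝒮 =
      ∑ A : Finset V, rhoI K u A ((𝒯 ∪ 𝒮).filter (· ∈ A)) *
        (corrK (cutCoupling K A) (𝒯.filter (· ∉ A)) * corrK (cutCoupling K A) (𝒮.filter (· ∉ A))) := by
  have hZ : 0 < wcurrentSum K (∅ : Finset V) := wcurrentSum_empty_pos hK
  have hZA : ∀ A : Finset V, 0 < wcurrentSum (cutCoupling K A) (∅ : Finset V) :=
    fun A => wcurrentSum_empty_pos (cutCoupling_nonneg hK A)
  -- the identity multiplied out: Z[𝒯] Z[𝒮] = Σ_A J_A(...)·Z_A[𝒯∖A] Z_A[𝒮∖A]/Z_A[∅]²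
  have hprod : wcurrentSum K 𝒯 * wcurrentSum K 𝒮 =
      ∑ A : Finset V, (jmass K u A ((𝒯 ∪ 𝒮).filter (· ∈ A)) ∅).toReal *
        (wcurrentSum (cutCoupling K A) (𝒯.filter (· ∉ A)) * wcurrentSum (cutCoupling K A) (𝒮.filter (· ∉ A))) /
        (wcurrentSum (cutCoupling K A) ∅ * wcurrentSum (cutCoupling K A) ∅) := by
    have h := tsum_epairWeight_eq_sum_jmass K u 𝒯 𝒮
    apply_fun ENNReal.toReal at h
    rw [ENNReal.toReal_mul, toReal_ecurrentSum hK, toReal_ecurrentSum hK,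
      ENNReal.toReal_sum (fun A _ => jmass_ne_top hK u A 𝒯 𝒮)] at h
    rw [h]
    refine Finset.sum_congr rfl fun A _ => ?_
    rw [eq_div_iff (mul_pos (hZA A) (hZA A)).ne', toReal_jmass_mul_eq hK u A hd h𝒮]
  -- divide by `Z[∅]²`
  unfold corrK rhoI
  rw [div_mul_div_comm, hprod, Finset.sum_div]
  refine Finset.sum_congr rfl fun A _ => ?_
  have hA := (hZA A).ne'
  field_simp

end Current

end Literature.Probability.LatticeModels

end
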